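import Summits.HodgeConjecture.HodgeConjecture.Theorems.K2E3LevelOperatorConjugation   -- ★ p855120 (this seat): `levelOp_mul_of_map_conj_eq` (multiplicativity of `k ↦ L_k` on the normaliser)
import Mathlib.Topology.Algebra.Group.Compact
import HarnessLib

/-!
# Crux `H413` — K2-LIT E3 «EllipticInputs», U12-h engine: THE LEVEL ACTION FACTORS THROUGH A FINITE QUOTIENT — `k ↦ L_k = e_{K′} π(k) e_{K′}` on `V^{K′}` is a
# representation of the compact open `K₁ ⊵ K′` pulled back from a FINITE group `Q = K₁ ∕ ker` (existence theorem; no `def`)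

Cell `hodgecm-mathlib`, Track B «K2-LIT», crux item `stmt-HodgeConjecture-24833` (h413), line `K2_E3_EllipticInputs`, socket U12-h `sig_K2E3CharLocConstNearRegular` (‹#9L›) ∕ STAB; seat
K2E3-p09 (g0).  `--supports stmt-HodgeConjecture-24833 --as helper`.  THEOREMS ONLY — no `def` (the finite group, the quotient map and the representation are produced
EXISTENTIALLY, so that ★ L2″ `K2E3IsotypicIdempotents.exists_isotypic_idempotents_representation` can be applied to them by any consumer without a definition leaf), no named
fact, no instance, no notation, no `sorry`.  GENERIC: topological group, representation over a field of characteristic zero.  HONEST LABEL: HC_CM is proved only modulo the 7 printed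
citations (2 remaining named inputs: hLiu418 = stmt-HodgeConjecture-24832, h413 = stmt-HodgeConjecture-24833) until rung 0 closes; count-neutral engine.

THE MATHEMATICS [HarishChandra1999, §14–§15 (the `K`-types of `V^{K′}`); BernsteinZelevinsky1976, §2.3].  `K₁` compact, `K′ ≤ K₁` open with `k K′ k⁻¹ = K′` for `k ∈ K₁`.  Then
`k ↦ L_k := e_{K′} π(k) e_{K′}` is multiplicative on `K₁` (★ `levelOp_mul_of_map_conj_eq`), trivial on `K′` (★ `levelOp_mul_of_mem_left`), hence a homomorphism
`Λ : K₁ → End(V^{K′})`; its kernel contains `K′`, which is open in the compact `K₁` and so of FINITE INDEX (quotient compact and discrete); `Q := K₁ ∕ ker Λ` is a finite group and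
`Λ` is the pull-back of the faithful `τ : Q → End(V^{K′})` (Mathlib `QuotientGroup.lift` along `ker Λ`).  The `Q`-isotypic components of `V^{K′}` are Harish-Chandra's `K₁`-types `d` of
level `K′`; ★ L2″ supplies their projectors `P_d`, ★ L2 the expansion `tr π(f) = Σ_d ∫ f Θ_d`, ★ L2′∕L3∕L4 their invariance ∕ intertwining ∕ admissibility properties.

* `levelOp_eq_one_of_mem` (`L_k = 1` for `k ∈ K′`), `finiteIndex_subgroupOf_of_isOpen_of_isCompact`, **`exists_representation_finite_quotient_levelOp`**.

## References
* [HarishChandra1999] Harish-Chandra (DeBacker–Sally), *Admissible Invariant Distributions on Reductive p-adic Groups*, ULECT 16 (1999), §14–§15.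
* [BernsteinZelevinsky1976] I. N. Bernstein, A. V. Zelevinsky, Russian Math. Surveys 31:3 (1976), §2.3.
-/

set_option autoImplicit false
-- the mandated namespace repeats `HodgeConjecture.HodgeConjecture`, as in every `Theorems/*.lean` of this sub-problem
set_option linter.dupNamespace false

noncomputable section

open Topology
open Literature.NumberTheory.Automorphic Literature.NumberTheory.Automorphic.SmoothProjector
open Summit.HodgeConjecture.HodgeConjecture.Cruxes.H413.K2E3LevelOperatorConjugation

namespace Summit.HodgeConjecture.HodgeConjecture.Cruxes.H413.K2E3LevelQuotientRepresentation

universe uG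

variable {k V : Type*} {G : Type uG} [Field k] [CharZero k] [Group G] [TopologicalSpace G] [IsTopologicalGroup G] [AddCommGroup V] [Module k V]
  (ρ : Representation k G V) {K' : Subgroup G}

/-- `L_x = 1` on `V^{K′}` for `x ∈ K′` (★ `levelOp_mul_of_mem_left` at `g = 1`, ★ `levelOp_one`). [cite: BernsteinZelevinsky1976, §2.3] -/
theorem levelOp_eq_one_of_mem (hKo : IsOpen (K' : Set G)) (hKc : IsCompact (K' : Set G)) {x : G} (hx : x ∈ K') :
    ρ.levelOp hKo hKc x = 1 := by
  rw [← mul_one x, ρ.levelOp_mul_of_mem_left hKo hKc 1 hx]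
  exact ρ.levelOp_one hKo hKc

omit [CharZero k] in
/-- **An open subgroup of a compact subgroup has finite index in it** (the quotient is compact and discrete): for `K′` open and `K₁` compact, `K′ ∩ K₁` has finite index in `K₁`.
[cite: BernsteinZelevinsky1976, §2.3] -/
theorem finiteIndex_subgroupOf_of_isOpen_of_isCompact {K₁ : Subgroup G} (hKo : IsOpen (K' : Set G)) (hK₁c : IsCompact (K₁ : Set G)) :
    (K'.subgroupOf K₁).FiniteIndex := by
  haveI : CompactSpace ↥K₁ := isCompact_iff_compactSpace.1 hK₁c
  have hopen : IsOpen ((K'.subgroupOf K₁ : Subgroup ↥K₁) : Set ↥K₁) := hKo.preimage continuous_subtype_val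
  haveI : DiscreteTopology (↥K₁ ⧸ K'.subgroupOf K₁) := QuotientGroup.discreteTopology_iff.mpr hopen
  haveI : Finite (↥K₁ ⧸ K'.subgroupOf K₁) := finite_of_compact_of_discrete
  exact Subgroup.finiteIndex_of_finite_quotient

/-- **THE LEVEL ACTION OF `K₁` ON `V^{K′}` IS PULLED BACK FROM A FINITE GROUP.**  `K′` compact open and normalised by `K₁` (`k K′ k⁻¹ = K′`), `K₁` compact.  There are a
FINITE group `Q`, a surjection `φ : K₁ ↠ Q` killing `K′`, and a representation `τ` of `Q` on `V^{K′}` with `τ(φ k) = L_k = e_{K′} π(k) e_{K′}` for every `k ∈ K₁`.  (Take `Q = K₁ ∕ ker Λ`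
for the homomorphism `Λ : k ↦ L_k`, ★ `levelOp_mul_of_map_conj_eq`; finiteness from `finiteIndex_subgroupOf_of_isOpen_of_isCompact` and `K′ ≤ ker Λ`.)  With `V^{K′}` finite-dimensional
(admissibility) ★ `exists_isotypic_idempotents_representation τ` then yields Harish-Chandra's `K₁`-type projectors of level `K′`, commuting with every `L_k`.
[cite: HarishChandra1999, §14–§15] [cite: BernsteinZelevinsky1976, §2.3] -/
theorem exists_representation_finite_quotient_levelOp {K₁ : Subgroup G} (hKo : IsOpen (K' : Set G)) (hKc : IsCompact (K' : Set G))
    (hK₁c : IsCompact (K₁ : Set G)) (hnorm : ∀ x ∈ K₁, K'.map (MulAut.conj x).toMonoidHom = K') :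
    ∃ (Q : Type uG) (_ : Group Q) (_ : Finite Q) (φ : ↥K₁ →* Q) (τ : Representation k Q (ρ.fixedPoints K')),
      Function.Surjective φ ∧ (∀ x : ↥K₁, τ (φ x) = ρ.levelOp hKo hKc (x : G)) ∧ (∀ x : ↥K₁, (x : G) ∈ K' → φ x = 1) := by
  -- the homomorphism `Λ : K₁ → End(V^{K′})`, `x ↦ L_x`
  let Λ : Representation k ↥K₁ (ρ.fixedPoints K') :=
    { toFun := fun x => ρ.levelOp hKo hKc (x : G)
      map_one' := ρ.levelOp_one hKo hKc
      map_mul' := fun x y => (levelOp_mul_of_map_conj_eq ρ hKo hKc (hnorm x x.2) (y : G)).symm }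
  have hΛ : ∀ x : ↥K₁, Λ x = ρ.levelOp hKo hKc (x : G) := fun x => rfl
  -- `K′ ≤ ker Λ`, so `ker Λ` has finite index and `Q = K₁ ∕ ker Λ` is finite
  have hker : K'.subgroupOf K₁ ≤ Λ.ker := fun x hx => by
    rw [MonoidHom.mem_ker, hΛ]
    exact levelOp_eq_one_of_mem ρ hKo hKc (Subgroup.mem_subgroupOf.1 hx)
  haveI : (K'.subgroupOf K₁).FiniteIndex := finiteIndex_subgroupOf_of_isOpen_of_isCompact hKo hK₁c
  haveI : Λ.ker.FiniteIndex := Subgroup.finiteIndex_of_le hker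
  haveI : Finite (↥K₁ ⧸ Λ.ker) := Subgroup.finite_quotient_of_finiteIndex
  have hsurj : Function.Surjective (QuotientGroup.mk' Λ.ker) := QuotientGroup.mk'_surjective _
  have hlift : ∀ x : ↥K₁, QuotientGroup.lift Λ.ker Λ le_rfl (QuotientGroup.mk' Λ.ker x) = ρ.levelOp hKo hKc (x : G) := fun x => by
    rw [QuotientGroup.mk'_apply, QuotientGroup.lift_mk, hΛ]
  have hone : ∀ x : ↥K₁, (x : G) ∈ K' → QuotientGroup.mk' Λ.ker x = 1 := fun x hx => by
    rw [QuotientGroup.mk'_apply, QuotientGroup.eq_one_iff]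
    exact hker (Subgroup.mem_subgroupOf.2 hx)
  exact ⟨↥K₁ ⧸ Λ.ker, inferInstance, inferInstance, QuotientGroup.mk' Λ.ker, QuotientGroup.lift Λ.ker Λ le_rfl, hsurj, hlift, hone⟩

end Summit.HodgeConjecture.HodgeConjecture.Cruxes.H413.K2E3LevelQuotientRepresentation

end
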